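/-
Copyright (c) 2026 the pub-hodgecm-mathlib formalisation cell (harness21).  Prover seat hodgecm-mathlib-K2Liu-p05 (g2), 2026-09-04
(Track B «K2-LIT», crux hLiu418 = stmt-HodgeConjecture-24832, organ (L24-a) of socket #24i∕#30i `sig_K2LiuThetaTypeSphericalEigenvalueInert`,
LEAD F0P6-plan (g11) RULING «M-155g» (ii)).
-/
import Summits.HodgeConjecture.HodgeConjecture.Theorems.K2LiuInertWeilSphericalLineFrame   -- ★ (this seat) §5–§7: the line from an integral hyperbolic frame
import Literature.NumberTheory.Automorphic.UnitaryGroupDualPairLocalLine                 -- ★ `localLineInl`, `localLineInl_surjective`, `localLineInl_mapsTo_localInt`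
import HarnessLib

/-!
# (L24-a) at the HYPERSPECIAL `U(J)(𝒪_v)`: root elements with integral data are integral points, `U(J_V ⊗ J_W)(𝒪_v) = localLineInl(U(J_V)(𝒪_v))`,
# and the line `ω_v^{U(J)(𝒪_v)} = ℂ · 1_{𝒪_vᴺ}` ∕ the θ-factor bound from an integral hyperbolic frame — the form (L24-c) consumes

Topic: crux hLiu418 (stmt-HodgeConjecture-24832), Track B «K2-LIT», socket #24i∕#30i `sig_K2LiuThetaTypeSphericalEigenvalueInert`, organ (L24-a)
(LEAD F0P6-plan (g11) RULING «M-155g» (ii)); sequel of ★ `K2LiuInertWeilSphericalLine` (engine), ★ `…OfRoots` ((ISO) ⇒ expansion), ★ `…Frame`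
(frame ⇒ (ISO), for any `K` containing the root elements) and ★ `K2LiuLocalRingReImDictionary`.  Namespace
`Summit.HodgeConjecture.HodgeConjecture.Cruxes.HLiu418.K2LiuInertWeilSphericalLine` (continued).  THEOREMS ONLY (no definition, no named fact, no instance,
no notation, no `sorry`); `--supports stmt-HodgeConjecture-24832 --as helper`; count-neutral.

THE MATHEMATICS ([PlatonovRapinchuk1994, §5.1]; [MoeglinVignerasWaldspurger1987, Chap. 5 I.4, I.11]).  §8: the root element `n_{bδ}(r)` of an INTEGRAL isotropic
`r ∈ 𝒪_{E_v}ᴺ` with `b ∈ 𝒪_v` has matrix `1 + (ι_v(b)δ) · r ⊗ h(r, ·)` with integral entries, and inverse `n_{(-b)δ}(r)`, so it lies in `U(J)(𝒪_v)` (★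
`localInt`: every `w`-component in `GL_N(𝒪_w)`).  §9: for a line `J_W = (j)`, `U(J_V ⊗ J_W)(𝒪_v)` is EXACTLY the image of `U(J_V)(𝒪_v)` under
★ `localLineInl` (the entries of `k^{±1}` are entries of `reindex e (k^{±1} ⊗ 1)`), so the `U(J_V)(𝒪_v)`-fixed vectors of a pull-back `σ ∘ localLineInl` are the
`U(J_V ⊗ J_W)(𝒪_v)`-fixed vectors of `σ` (★ `fixedPoints_comp`).  §10 HEADS at `K = U(J)(𝒪_v)`: at a place with ONE `w ∣ v`, `2` a `v`-unit, `δ` a `w`-unit,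
`ψ_v` of conductor `𝒪_v`, `𝕋_v` `v`-integral (all cofinite: ★ §7 of `…Frame`), `1_{𝒪_vᴺ} ∈ ω_v^{U(J)(𝒪_v)}` (★ Ω1 `unitVec_mem_fixedPoints`, cofinite), and an
integral hyperbolic frame `(y, ys)` of `E_vᴺ` (isotropic, integral, `x = h(ys,x) y + h(y,x) ys`; at an inert good place of a rank-2 form: `(T⁻¹e₀, T⁻¹e₁)` of
#28i∕#24i's `T ∈ GL₂(𝒪_w)`, ★ K2Liu-p01 `hermForm_formCongr_frameVec`): `ω_v^{U(J)(𝒪_v)} = ℂ ∙ 1_{𝒪_vᴺ}`, the `χ`-coinvariant line bound, and its pull-back along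
`localLineInl` to `U(J_V)(𝒪_v)` — the LOCAL eigen-line (L24-c) feeds to ★ `IsHyperspecialAt.heckeOperator_inclPlace_apply_eq_smul`.

HONEST LABEL: HC_CM is proved only modulo the 7 printed citations (2 remaining named inputs: hLiu418 = stmt-HodgeConjecture-24832, h413 =
stmt-HodgeConjecture-24833) until rung 0 closes; count-neutral helper toward #24i, closes nothing.

## References
* [PlatonovRapinchuk1994] V. Platonov, A. Rapinchuk, *Algebraic Groups and Number Theory* (1994), §5.1 (`G_{𝒪_v}` of a matrix realisation).
* [MoeglinVignerasWaldspurger1987] C. Mœglin, M.-F. Vignéras, J.-L. Waldspurger, LNM 1291 (1987), Chap. 5 I.4, I.11.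
* [Dieudonne1971GroupesClassiques] J. Dieudonné, *La géométrie des groupes classiques* (1971), Chap. II §5.
* [Liu2021] Y. Liu, Camb. J. Math. 9 (2021), App. D §D.1, Lem. D.1.
-/

set_option autoImplicit false
set_option linter.dupNamespace false

noncomputable section

open NumberField IsDedekindDomain
open scoped Matrix NNReal Kronecker
open Literature.RepresentationTheory.HeisenbergGroup
open Literature.NumberTheory.Automorphic
open Literature.NumberTheory.Automorphic.UnitaryGroup
open Literature.NumberTheory.GelbartRogawski1991.UnitaryDualPair.LocalSplitting
open Literature.NumberTheory.GaloisRepresentations.IsNonarchimedeanLocalField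

namespace Summit.HodgeConjecture.HodgeConjecture.Cruxes.HLiu418.K2LiuInertWeilSphericalLine

/-! ## §8 Root elements with integral data lie in `U(J)(𝒪_v)`; §9 `U(J_V ⊗ J_W)(𝒪_v) = localLineInl (U(J_V)(𝒪_v))` -/

section LocalInt

variable {F : Type} [Field F] [NumberField F] (E : Type) [Field E] [NumberField E] [Algebra F E]
  [Algebra.IsQuadraticExtension F E] (c : E ≃ₐ[F] E) (N : ℕ) {δ : E} (hcδ : c δ = -δ) (hδ : δ ≠ 0)
  (T : Matrix (Fin N) (Fin N) F) {J : Matrix (Fin N) (Fin N) E} (hJ : J = T.map (algebraMap F E)) (hJh : (J.map c)ᵀ = J)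
  (v : HeightOneSpectrum (𝓞 F))

/-- the `w`-component matrix of the root element `n_{bδ}(r)` is the `w`-component of `lineRoot σ J_v r 0 (ι_v(b) δ) = 1 + (ι_v(b) δ) • r ⊗ h(r, ·)`.
[cite: Dieudonne1971GroupesClassiques, Chap. II §5] -/
theorem coe_localRootElt_apply {r : Fin N → LocalRing E v}
    (hr : hermForm (conjLocal E c v) ((adelicForm E N J).map (adeleToLocal E v)) r r = 0) (b : v.adicCompletion F)
    (w : PlacesOver E v) :
    ((((localRootElt E c N J v hcδ hδ hJh hr b : localPi E c N J v) : LocalGLPi E N v) w : GL (Fin N) (w.1.adicCompletion E)) :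
        Matrix (Fin N) (Fin N) (w.1.adicCompletion E)) =
      (lineRoot (conjLocal E c v) ((adelicForm E N J).map (adeleToLocal E v)) r 0
        (toLocalRing E v b * algebraMap E (LocalRing E v) δ)).map (Pi.evalRingHom _ w) := by
  have h1 : ((localRootElt E c N J v hcδ hδ hJh hr b : localPi E c N J v) : LocalGLPi E N v) =
      localGLPiEquiv E N v ((localPiEquiv E c N J v (localRootElt E c N J v hcδ hδ hJh hr b) : «local» E c N J v) :
        GL (Fin N) (LocalRing E v)) := by
    rw [coe_localPiEquiv_apply, ContinuousMulEquiv.apply_symm_apply]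
  rw [h1, GLn.coe_piEquiv_apply, coe_localPiEquiv_localRootElt]

include hJ in
omit [Algebra.IsQuadraticExtension F E] in
/-- the row `h(r, ·) = (σ r)ᵀ 𝕋_v` of an integral vector is integral at every `w ∣ v` (`𝕋_v` `v`-integral). [cite: PlatonovRapinchuk1994, §5.1] -/
theorem hermRow_apply_mem_integers (hTi : ∀ i j, localGram F N T v i j ∈
      primePowBall (v.adicCompletion F) 0)
    {r : Fin N → LocalRing E v} (hri : ∀ (j : Fin N) (w : PlacesOver E v), r j w ∈ w.1.adicCompletionIntegers E)
    (j : Fin N) (w : PlacesOver E v) :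
    hermRow (conjLocal E c v) ((adelicForm E N J).map (adeleToLocal E v)) r j w ∈ w.1.adicCompletionIntegers E := by
  rw [localForm_eq_map E N v T hJ, hermRow, Matrix.vecMul, dotProduct, Finset.sum_apply]
  refine sum_mem fun i _ => ?_
  rw [Pi.mul_apply, Function.comp_apply, Matrix.map_apply, Matrix.map_apply, toLocalRing_apply, conjLocal_apply]
  refine mul_mem ?_ (toPlace_mem_adicCompletionIntegers v w ((mem_primePowBall_zero_iff _).1 (hTi i j)))
  exact (galAdicCompletionMap_mem_adicCompletionIntegers_iff E c (smul_inv_smul c w.1) _).2 (hri i ⟨c⁻¹ • w.1, under_inv_smul_eq c w⟩)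

include hJ in
/-- the entries of the `w`-component of `n_{bδ}(r)` are integral for `r` integral, `b ∈ 𝒪_v`, `δ` integral above `v`, `𝕋_v` `v`-integral.
[cite: PlatonovRapinchuk1994, §5.1] -/
theorem coe_localRootElt_apply_mem_integers
    (hTi : ∀ i j, localGram F N T v i j ∈
      primePowBall (v.adicCompletion F) 0)
    (hδi : ∀ w : PlacesOver E v, algebraMap E (LocalRing E v) δ w ∈ w.1.adicCompletionIntegers E)
    {r : Fin N → LocalRing E v}
    (hr : hermForm (conjLocal E c v) ((adelicForm E N J).map (adeleToLocal E v)) r r = 0)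
    (hri : ∀ (j : Fin N) (w : PlacesOver E v), r j w ∈ w.1.adicCompletionIntegers E)
    {b : v.adicCompletion F} (hb : b ∈ v.adicCompletionIntegers F) (w : PlacesOver E v) (i j : Fin N) :
    ((((localRootElt E c N J v hcδ hδ hJh hr b : localPi E c N J v) : LocalGLPi E N v) w : GL (Fin N) (w.1.adicCompletion E)) :
        Matrix (Fin N) (Fin N) (w.1.adicCompletion E)) i j ∈ w.1.adicCompletionIntegers E := by
  rw [coe_localRootElt_apply E c N hcδ hδ hJh v hr b w, Matrix.map_apply, lineRoot_zero_left, Matrix.add_apply, Matrix.smul_apply,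
    Matrix.vecMulVec_apply, smul_eq_mul, Pi.evalRingHom_apply, Pi.add_apply, Pi.mul_apply, Pi.mul_apply, Pi.mul_apply]
  refine add_mem ?_ (mul_mem (mul_mem ?_ (hδi w)) (mul_mem (hri i w) (hermRow_apply_mem_integers E c N T hJ v hTi hri j w)))
  · rw [Matrix.one_apply]
    split_ifs
    · exact one_mem _
    · exact zero_mem _
  · rw [toLocalRing_apply]
    exact toPlace_mem_adicCompletionIntegers v w hb

/-- `n_{bδ}(r)⁻¹ = n_{(-b)δ}(r)` (★ `localRootElt_add`, `localRootElt_zero`). [cite: Dieudonne1971GroupesClassiques, Chap. II §5] -/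
theorem localRootElt_inv {r : Fin N → LocalRing E v}
    (hr : hermForm (conjLocal E c v) ((adelicForm E N J).map (adeleToLocal E v)) r r = 0) (b : v.adicCompletion F) :
    (localRootElt E c N J v hcδ hδ hJh hr b)⁻¹ = localRootElt E c N J v hcδ hδ hJh hr (-b) := by
  refine inv_eq_of_mul_eq_one_right ?_
  rw [← localRootElt_add, add_neg_cancel, localRootElt_zero]

include hJ in
/-- **root elements with integral data lie in the hyperspecial `U(J)(𝒪_v)`** (★ `localInt`): for `r ∈ 𝒪_{E_v}ᴺ` isotropic, `b ∈ 𝒪_v`, `δ` integral above `v` and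
`𝕋_v` `v`-integral, `n_{bδ}(r) ∈ U(J)(𝒪_v)` (its matrix and the matrix of its inverse `n_{(-b)δ}(r)` are integral at every `w ∣ v`).
[cite: PlatonovRapinchuk1994, §5.1] [cite: Dieudonne1971GroupesClassiques, Chap. II §5] -/
theorem localRootElt_mem_localInt
    (hTi : ∀ i j, localGram F N T v i j ∈
      primePowBall (v.adicCompletion F) 0)
    (hδi : ∀ w : PlacesOver E v, algebraMap E (LocalRing E v) δ w ∈ w.1.adicCompletionIntegers E)
    {r : Fin N → LocalRing E v}
    (hr : hermForm (conjLocal E c v) ((adelicForm E N J).map (adeleToLocal E v)) r r = 0)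
    (hri : ∀ (j : Fin N) (w : PlacesOver E v), r j w ∈ w.1.adicCompletionIntegers E)
    {b : v.adicCompletion F} (hb : b ∈ v.adicCompletionIntegers F) :
    localRootElt E c N J v hcδ hδ hJh hr b ∈ localInt E c N J v := by
  rw [mem_localInt_iff]
  intro w
  -- `𝒪[E_w]` of ★ `glInt` is the valuation ring of the `ValuativeRel` valuation; convert from `Valued.v`
  have conv : ∀ y : w.1.adicCompletion E, y ∈ w.1.adicCompletionIntegers E →
      ValuativeRel.valuation (w.1.adicCompletion E) y ≤ 1 := fun y hy => by
    have h := (valuation_le_valuation_iff_valued (K := E) w.1 y 1).2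
      (by rw [map_one]; exact (HeightOneSpectrum.mem_adicCompletionIntegers _ _ _).1 hy)
    rwa [map_one] at h
  rw [mem_glInt_iff]
  refine ⟨fun i j => (Valuation.mem_integer_iff _ _).2 (conv _
    (coe_localRootElt_apply_mem_integers E c N hcδ hδ T hJ hJh v hTi hδi hr hri hb w i j)), fun i j =>
    (Valuation.mem_integer_iff _ _).2 (conv _ ?_)⟩
  rw [← Pi.inv_apply, ← Subgroup.coe_inv, localRootElt_inv]
  exact coe_localRootElt_apply_mem_integers E c N hcδ hδ T hJ hJh v hTi hδi hr hri (neg_mem hb) w i j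

omit [Algebra.IsQuadraticExtension F E] in
/-- **`U(J_V ⊗ J_W)(𝒪_v)` is the image of `U(J_V)(𝒪_v)` under `localLineInl`** (for a line `J_W = (j)`, `j ≠ 0`): `⊆` is ★ `localLineInl_mapsTo_localInt`; `⊇` by ★
`localLineInl_surjective` — the entries of `k` and `k⁻¹` are entries of `reindex e (k ⊗ 1)` and its inverse. [cite: PlatonovRapinchuk1994, §5.1] [cite: Liu2021, App. D §D.1 (l. 5213–5224)] -/
theorem map_localLineInl_localInt_eq {n : ℕ} (e : Fin N × Fin 1 ≃ Fin n) (JW : Matrix (Fin 1) (Fin 1) E) (hJW0 : JW 0 0 ≠ 0) :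
    (localInt E c N J v).map (localLineInl E c N e J JW v) = localInt E c n (Matrix.reindex e e (J ⊗ₖ JW)) v := by
  refine le_antisymm ?_ fun g hg => ?_
  · rintro _ ⟨k, hk, rfl⟩
    exact localLineInl_mapsTo_localInt E c N e J JW v hk
  · obtain ⟨k, rfl⟩ := localLineInl_surjective E c N e J JW hJW0 v g
    refine ⟨k, ?_, rfl⟩
    rw [mem_localInt_iff] at hg
    change k ∈ localInt E c N J v
    rw [mem_localInt_iff]
    intro w
    obtain ⟨h1, h2⟩ := (mem_glInt_iff _).1 (hg w)
    rw [mem_glInt_iff]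
    refine ⟨fun i j => ?_, fun i j => ?_⟩
    · have h := h1 (e (i, 0)) (e (j, 0))
      rw [coe_localLineInl, coe_localLineGL_apply, Matrix.reindex_apply, Matrix.submatrix_apply, Equiv.symm_apply_apply,
        Equiv.symm_apply_apply, Matrix.kroneckerMap_apply, Matrix.one_apply_eq, mul_one] at h
      exact h
    · have h := h2 (e (i, 0)) (e (j, 0))
      rw [coe_localLineInl, coe_localLineGL_apply_inv, Matrix.reindex_apply, Matrix.submatrix_apply, Equiv.symm_apply_apply,
        Equiv.symm_apply_apply, Matrix.kroneckerMap_apply, Matrix.one_apply_eq, mul_one] at h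
      exact h

end LocalInt

/-! ## §10 Heads at the hyperspecial `K = U(J)(𝒪_v)` and the pull-back along `localLineInl` -/

section Heads

variable {F : Type} [Field F] [NumberField F] (E : Type) [Field E] [NumberField E] [Algebra F E]
  [Algebra.IsQuadraticExtension F E] (c : E ≃ₐ[F] E) (N : ℕ) {δ : E} (hcδ : c δ = -δ) (hδ : δ ≠ 0) {d : F}
  (hd : δ * δ = algebraMap F E d) (T : Matrix (Fin N) (Fin N) F) (hT : T.IsSymm)
  {J : Matrix (Fin N) (Fin N) E} (hJ : J = T.map (algebraMap F E)) (hJh : (J.map c)ᵀ = J)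
  (v : HeightOneSpectrum (𝓞 F))

include hJh in
/-- **(L24-a) AT THE HYPERSPECIAL SUBGROUP: `ω_v^{U(J)(𝒪_v)} = ℂ ∙ 1_{𝒪_vᴺ}`.**  At a place `v` with ONE place `w₀` above it, `2` a `v`-unit, `δ` a `w₀`-unit, `ψ_v` of
conductor `𝒪_v`, `det T` a unit and `𝕋_v` `v`-integral, if `U(J)(𝒪_v)` fixes `1_{𝒪_vᴺ}` under `ω_v` (★ Ω1) and `E_vᴺ` carries an INTEGRAL HYPERBOLIC FRAME `(y, ys)`
(integral isotropic vectors with `x = h(ys, x) y + h(y, x) ys` for all `x`), then the `U(J)(𝒪_v)`-fixed vectors of `ω_v` are exactly `ℂ ∙ 1_{𝒪_vᴺ}` — the root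
elements of the frame lie in `U(J)(𝒪_v)` (§8) and ★ `fixedPoints_omegaLoc_eq_span_unitVec_of_frame` applies.
[cite: MoeglinVignerasWaldspurger1987, Chap. 5 I.4, I.11] [cite: Howe1979, §2] -/
theorem fixedPoints_omegaLoc_localInt_eq_span_unitVec_of_frame (𝓢 : FinLocalSplittings F E c N hcδ hδ hd T hT hJ) (hTd : IsUnit T.det)
    (w₀ : PlacesOver E v) (hw₀ : ∀ w : PlacesOver E v, w = w₀) (h2 : Valued.v (2 : v.adicCompletion F) = 1)
    (hδu : ∀ w : PlacesOver E v, Valued.v (algebraMap E (LocalRing E v) δ w) = 1)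
    (hcond : (adeleAddCharAt F v).HasConductorExp 0)
    (hTi : ∀ i j, localGram F N T v i j ∈ primePowBall (v.adicCompletion F) 0)
    (hunr : unitVec F (Fin N) v ∈ (𝓢.omegaLoc v).fixedPoints (localInt E c N J v)) {y ys : Fin N → LocalRing E v}
    (hy : hermForm (conjLocal E c v) ((adelicForm E N J).map (adeleToLocal E v)) y y = 0)
    (hys : hermForm (conjLocal E c v) ((adelicForm E N J).map (adeleToLocal E v)) ys ys = 0)
    (hyi : ∀ (j : Fin N) (w : PlacesOver E v), y j w ∈ w.1.adicCompletionIntegers E)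
    (hysi : ∀ (j : Fin N) (w : PlacesOver E v), ys j w ∈ w.1.adicCompletionIntegers E)
    (hframe : ∀ x : Fin N → LocalRing E v,
      x = hermForm (conjLocal E c v) ((adelicForm E N J).map (adeleToLocal E v)) ys x • y +
        hermForm (conjLocal E c v) ((adelicForm E N J).map (adeleToLocal E v)) y x • ys) :
    (𝓢.omegaLoc v).fixedPoints (localInt E c N J v) = ℂ ∙ unitVec F (Fin N) v := by
  have h2ne : (2 : v.adicCompletion F) ≠ 0 := (isUnit_of_invertible (2 : v.adicCompletion F)).ne_zero
  have h2' : (⅟(2 : v.adicCompletion F) : v.adicCompletion F) ∈ v.adicCompletionIntegers F := by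
    rw [HeightOneSpectrum.mem_adicCompletionIntegers, invOf_eq_inv, map_inv₀, h2, inv_one]
  have hδi : ∀ w : PlacesOver E v, algebraMap E (LocalRing E v) δ w ∈ w.1.adicCompletionIntegers E := fun w => by
    rw [HeightOneSpectrum.mem_adicCompletionIntegers]
    exact (hδu w).le
  exact fixedPoints_omegaLoc_eq_span_unitVec_of_frame E c N hcδ hδ hd T hT hJ hJh v 𝓢 hTd w₀ hw₀ h2 h2' hδu hcond hTi
    (localInt E c N J v) (fun k hk => ((𝓢.omegaLoc v).mem_fixedPoints _ _).1 hunr k hk) hy hys hyi hysi hframe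
    (fun b hb => localRootElt_mem_localInt E c N hcδ hδ T hJ hJh v hTi hδi hy hyi hb)
    (fun b hb => localRootElt_mem_localInt E c N hcδ hδ T hJ hJh v hTi hδi hys hysi hb)

include hJh in
/-- **(L24-a) FOR THE LOCAL θ-FACTOR AT THE HYPERSPECIAL SUBGROUP**: under the hypotheses of `fixedPoints_omegaLoc_localInt_eq_span_unitVec_of_frame`, the
`U(J)(𝒪_v)`-fixed vectors of the `χ`-coinvariants `TwistedCoinv.rep χ (ω_v) _` (any commuting `ρW` — e.g. the centre through ★ `localCenter` — and any `χ`) lie on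
`ℂ ∙ [1_{𝒪_vᴺ}]` (`U(J)(𝒪_v)` is compact, ★ `isCompact_localInt`). [cite: MoeglinVignerasWaldspurger1987, Chap. 3 §IV.4, Chap. 5 I.11] [cite: Liu2021, App. D Lem. D.1] -/
theorem fixedPoints_twistedCoinv_omegaLoc_localInt_le_span_of_frame (𝓢 : FinLocalSplittings F E c N hcδ hδ hd T hT hJ) (hTd : IsUnit T.det)
    (w₀ : PlacesOver E v) (hw₀ : ∀ w : PlacesOver E v, w = w₀) (h2 : Valued.v (2 : v.adicCompletion F) = 1)
    (hδu : ∀ w : PlacesOver E v, Valued.v (algebraMap E (LocalRing E v) δ w) = 1)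
    (hcond : (adeleAddCharAt F v).HasConductorExp 0)
    (hTi : ∀ i j, localGram F N T v i j ∈ primePowBall (v.adicCompletion F) 0)
    (hunr : unitVec F (Fin N) v ∈ (𝓢.omegaLoc v).fixedPoints (localInt E c N J v)) {y ys : Fin N → LocalRing E v}
    (hy : hermForm (conjLocal E c v) ((adelicForm E N J).map (adeleToLocal E v)) y y = 0)
    (hys : hermForm (conjLocal E c v) ((adelicForm E N J).map (adeleToLocal E v)) ys ys = 0)
    (hyi : ∀ (j : Fin N) (w : PlacesOver E v), y j w ∈ w.1.adicCompletionIntegers E)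
    (hysi : ∀ (j : Fin N) (w : PlacesOver E v), ys j w ∈ w.1.adicCompletionIntegers E)
    (hframe : ∀ x : Fin N → LocalRing E v,
      x = hermForm (conjLocal E c v) ((adelicForm E N J).map (adeleToLocal E v)) ys x • y +
        hermForm (conjLocal E c v) ((adelicForm E N J).map (adeleToLocal E v)) y x • ys)
    {H : Type*} [Group H] {ρW : Representation ℂ H (SchwartzBruhat (Fin N → v.adicCompletion F))} (χ : H →* ℂˣ)
    (hc : ∀ (g : UnitaryGroup.localPi E c N J v) (h : H), Commute (𝓢.omegaLoc v g) (ρW h)) :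
    (Literature.RepresentationTheory.TwistedCoinv.rep χ (𝓢.omegaLoc v) hc).fixedPoints (localInt E c N J v) ≤
      ℂ ∙ Literature.RepresentationTheory.TwistedCoinv.mk ρW χ (unitVec F (Fin N) v) :=
  fixedPoints_twistedCoinv_le_span (𝓢.omegaLoc v) (𝓢.isSmooth_omegaLoc v) χ hc (isCompact_localInt E c N J v)
    (fixedPoints_omegaLoc_localInt_eq_span_unitVec_of_frame E c N hcδ hδ hd T hT hJ hJh v 𝓢 hTd w₀ hw₀ h2 hδu hcond hTi hunr hy hys hyi
      hysi hframe).le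

end Heads

/-! ### The pull-back to `U(J_V)(𝒪_v)` along `localLineInl` (the local factor of [Liu2021, Def. 4.11]'s carrier, S4c-H shape) -/

section PullBack

variable {F : Type} [Field F] [NumberField F] (E : Type) [Field E] [NumberField E] [Algebra F E]
  [Algebra.IsQuadraticExtension F E] (c : E ≃ₐ[F] E) (N : ℕ) {n : ℕ} (e : Fin N × Fin 1 ≃ Fin n)
  (JV : Matrix (Fin N) (Fin N) E) (JW : Matrix (Fin 1) (Fin 1) E) (hJW0 : JW 0 0 ≠ 0)
  {δ : E} (hcδ : c δ = -δ) (hδ : δ ≠ 0) {d : F} (hd : δ * δ = algebraMap F E d) (T : Matrix (Fin n) (Fin n) F) (hT : T.IsSymm)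
  (hJ : Matrix.reindex e e (JV ⊗ₖ JW) = T.map (algebraMap F E)) (hJh : ((Matrix.reindex e e (JV ⊗ₖ JW)).map c)ᵀ = Matrix.reindex e e (JV ⊗ₖ JW))
  (v : HeightOneSpectrum (𝓞 F))

include hJh hJW0 in
/-- **(L24-a) ON `U(J_V)(F_v)` ALONG `localLineInl` — the S4c-H local factor**: for a family `𝓢` of local splittings of `U(J_V ⊗ J_W)(F_v)` (`J_W` a non-degenerate
line) and the hypotheses of `fixedPoints_twistedCoinv_omegaLoc_localInt_le_span_of_frame` for that group, the `U(J_V)(𝒪_v)`-fixed vectors of the pulled-back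
θ-factor `(TwistedCoinv.rep χ ω_v _) ∘ localLineInl v` lie on `ℂ ∙ [1_{𝒪_vⁿ}]` (§9: `localLineInl(U(J_V)(𝒪_v)) = U(J_V ⊗ J_W)(𝒪_v)`, ★ `fixedPoints_comp`).
[cite: Liu2021, Def. 4.11 (l. 2092–2096), App. D Lem. D.1] [cite: MoeglinVignerasWaldspurger1987, Chap. 5 I.11] -/
theorem fixedPoints_twistedCoinv_omegaLoc_comp_localLineInl_le_span_of_frame
    (𝓢 : FinLocalSplittings F E c n hcδ hδ hd T hT hJ) (hTd : IsUnit T.det)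
    (w₀ : PlacesOver E v) (hw₀ : ∀ w : PlacesOver E v, w = w₀) (h2 : Valued.v (2 : v.adicCompletion F) = 1)
    (hδu : ∀ w : PlacesOver E v, Valued.v (algebraMap E (LocalRing E v) δ w) = 1)
    (hcond : (adeleAddCharAt F v).HasConductorExp 0)
    (hTi : ∀ i j, localGram F n T v i j ∈ primePowBall (v.adicCompletion F) 0)
    (hunr : unitVec F (Fin n) v ∈ (𝓢.omegaLoc v).fixedPoints (localInt E c n (Matrix.reindex e e (JV ⊗ₖ JW)) v))
    {y ys : Fin n → LocalRing E v}
    (hy : hermForm (conjLocal E c v) ((adelicForm E n (Matrix.reindex e e (JV ⊗ₖ JW))).map (adeleToLocal E v)) y y = 0)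
    (hys : hermForm (conjLocal E c v) ((adelicForm E n (Matrix.reindex e e (JV ⊗ₖ JW))).map (adeleToLocal E v)) ys ys = 0)
    (hyi : ∀ (j : Fin n) (w : PlacesOver E v), y j w ∈ w.1.adicCompletionIntegers E)
    (hysi : ∀ (j : Fin n) (w : PlacesOver E v), ys j w ∈ w.1.adicCompletionIntegers E)
    (hframe : ∀ x : Fin n → LocalRing E v,
      x = hermForm (conjLocal E c v) ((adelicForm E n (Matrix.reindex e e (JV ⊗ₖ JW))).map (adeleToLocal E v)) ys x • y +
        hermForm (conjLocal E c v) ((adelicForm E n (Matrix.reindex e e (JV ⊗ₖ JW))).map (adeleToLocal E v)) y x • ys)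
    {H : Type*} [Group H] {ρW : Representation ℂ H (SchwartzBruhat (Fin n → v.adicCompletion F))} (χ : H →* ℂˣ)
    (hc : ∀ (g : UnitaryGroup.localPi E c n (Matrix.reindex e e (JV ⊗ₖ JW)) v) (h : H), Commute (𝓢.omegaLoc v g) (ρW h)) :
    Representation.fixedPoints
        ((Literature.RepresentationTheory.TwistedCoinv.rep χ (𝓢.omegaLoc v) hc).comp (localLineInl E c N e JV JW v))
        (localInt E c N JV v) ≤
      ℂ ∙ Literature.RepresentationTheory.TwistedCoinv.mk ρW χ (unitVec F (Fin n) v) := by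
  refine fixedPoints_comp_le_span _ _ _ ?_
  rw [map_localLineInl_localInt_eq E c N (J := JV) v e JW hJW0]
  exact fixedPoints_twistedCoinv_omegaLoc_localInt_le_span_of_frame E c n hcδ hδ hd T hT hJ hJh v 𝓢 hTd w₀ hw₀ h2 hδu hcond hTi hunr
    hy hys hyi hysi hframe χ hc

end PullBack

/-! ### The same for `ω_v` itself on `U(J_V)(𝒪_v)` (the `hline` of (L24-b)'s Hecke computation) -/

section PullBackOmega

variable {F : Type} [Field F] [NumberField F] (E : Type) [Field E] [NumberField E] [Algebra F E]
  [Algebra.IsQuadraticExtension F E] (c : E ≃ₐ[F] E) (N : ℕ) {n : ℕ} (e : Fin N × Fin 1 ≃ Fin n)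
  (JV : Matrix (Fin N) (Fin N) E) (JW : Matrix (Fin 1) (Fin 1) E) (hJW0 : JW 0 0 ≠ 0)
  {δ : E} (hcδ : c δ = -δ) (hδ : δ ≠ 0) {d : F} (hd : δ * δ = algebraMap F E d) (T : Matrix (Fin n) (Fin n) F) (hT : T.IsSymm)
  (hJ : Matrix.reindex e e (JV ⊗ₖ JW) = T.map (algebraMap F E)) (hJh : ((Matrix.reindex e e (JV ⊗ₖ JW)).map c)ᵀ = Matrix.reindex e e (JV ⊗ₖ JW))
  (v : HeightOneSpectrum (𝓞 F))

include hJh hJW0 in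
/-- **(L24-a) FOR `ω_v ∘ localLineInl` ON `U(J_V)(𝒪_v)`**: under the hypotheses of `fixedPoints_omegaLoc_localInt_eq_span_unitVec_of_frame` for the group
`U(J_V ⊗ J_W)(F_v)` (`J_W` a non-degenerate line), the `U(J_V)(𝒪_v)`-fixed vectors of the pulled-back Weil representation `ω_v ∘ localLineInl v` on `𝒮(F_vⁿ)` are
exactly `ℂ ∙ 1_{𝒪_vⁿ}` (§9 + ★ `fixedPoints_comp`) — the `hline` of the inert Hecke-eigenvalue computation (L24-b), in `fixedPoints (localInt V)` currency.
[cite: MoeglinVignerasWaldspurger1987, Chap. 5 I.4, I.11] [cite: Liu2021, Def. 4.11 (l. 2092–2096)] -/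
theorem fixedPoints_omegaLoc_comp_localLineInl_localInt_eq_span_unitVec_of_frame
    (𝓢 : FinLocalSplittings F E c n hcδ hδ hd T hT hJ) (hTd : IsUnit T.det)
    (w₀ : PlacesOver E v) (hw₀ : ∀ w : PlacesOver E v, w = w₀) (h2 : Valued.v (2 : v.adicCompletion F) = 1)
    (hδu : ∀ w : PlacesOver E v, Valued.v (algebraMap E (LocalRing E v) δ w) = 1)
    (hcond : (adeleAddCharAt F v).HasConductorExp 0)
    (hTi : ∀ i j, localGram F n T v i j ∈ primePowBall (v.adicCompletion F) 0)
    (hunr : unitVec F (Fin n) v ∈ (𝓢.omegaLoc v).fixedPoints (localInt E c n (Matrix.reindex e e (JV ⊗ₖ JW)) v))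
    {y ys : Fin n → LocalRing E v}
    (hy : hermForm (conjLocal E c v) ((adelicForm E n (Matrix.reindex e e (JV ⊗ₖ JW))).map (adeleToLocal E v)) y y = 0)
    (hys : hermForm (conjLocal E c v) ((adelicForm E n (Matrix.reindex e e (JV ⊗ₖ JW))).map (adeleToLocal E v)) ys ys = 0)
    (hyi : ∀ (j : Fin n) (w : PlacesOver E v), y j w ∈ w.1.adicCompletionIntegers E)
    (hysi : ∀ (j : Fin n) (w : PlacesOver E v), ys j w ∈ w.1.adicCompletionIntegers E)
    (hframe : ∀ x : Fin n → LocalRing E v,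
      x = hermForm (conjLocal E c v) ((adelicForm E n (Matrix.reindex e e (JV ⊗ₖ JW))).map (adeleToLocal E v)) ys x • y +
        hermForm (conjLocal E c v) ((adelicForm E n (Matrix.reindex e e (JV ⊗ₖ JW))).map (adeleToLocal E v)) y x • ys) :
    Representation.fixedPoints ((𝓢.omegaLoc v).comp (localLineInl E c N e JV JW v)) (localInt E c N JV v) = ℂ ∙ unitVec F (Fin n) v := by
  rw [Representation.fixedPoints_comp, map_localLineInl_localInt_eq E c N (J := JV) v e JW hJW0]
  exact fixedPoints_omegaLoc_localInt_eq_span_unitVec_of_frame E c n hcδ hδ hd T hT hJ hJh v 𝓢 hTd w₀ hw₀ h2 hδu hcond hTi hunr hy hys hyi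
    hysi hframe

include hJh hJW0 in
/-- the same in the `∀ f, … → ∃ a, f = a • 1_{𝒪_vⁿ}` form: every `f ∈ 𝒮(F_vⁿ)` fixed by `U(J_V)(𝒪_v)` through `ω_v ∘ localLineInl v` is a multiple of `1_{𝒪_vⁿ}`.
[cite: MoeglinVignerasWaldspurger1987, Chap. 5 I.11] -/
theorem exists_eq_smul_unitVec_of_forall_omegaLoc_localLineInl_eq
    (𝓢 : FinLocalSplittings F E c n hcδ hδ hd T hT hJ) (hTd : IsUnit T.det)
    (w₀ : PlacesOver E v) (hw₀ : ∀ w : PlacesOver E v, w = w₀) (h2 : Valued.v (2 : v.adicCompletion F) = 1)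
    (hδu : ∀ w : PlacesOver E v, Valued.v (algebraMap E (LocalRing E v) δ w) = 1)
    (hcond : (adeleAddCharAt F v).HasConductorExp 0)
    (hTi : ∀ i j, localGram F n T v i j ∈ primePowBall (v.adicCompletion F) 0)
    (hunr : unitVec F (Fin n) v ∈ (𝓢.omegaLoc v).fixedPoints (localInt E c n (Matrix.reindex e e (JV ⊗ₖ JW)) v))
    {y ys : Fin n → LocalRing E v}
    (hy : hermForm (conjLocal E c v) ((adelicForm E n (Matrix.reindex e e (JV ⊗ₖ JW))).map (adeleToLocal E v)) y y = 0)
    (hys : hermForm (conjLocal E c v) ((adelicForm E n (Matrix.reindex e e (JV ⊗ₖ JW))).map (adeleToLocal E v)) ys ys = 0)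
    (hyi : ∀ (j : Fin n) (w : PlacesOver E v), y j w ∈ w.1.adicCompletionIntegers E)
    (hysi : ∀ (j : Fin n) (w : PlacesOver E v), ys j w ∈ w.1.adicCompletionIntegers E)
    (hframe : ∀ x : Fin n → LocalRing E v,
      x = hermForm (conjLocal E c v) ((adelicForm E n (Matrix.reindex e e (JV ⊗ₖ JW))).map (adeleToLocal E v)) ys x • y +
        hermForm (conjLocal E c v) ((adelicForm E n (Matrix.reindex e e (JV ⊗ₖ JW))).map (adeleToLocal E v)) y x • ys)
    (f : SchwartzBruhat (Fin n → v.adicCompletion F))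
    (hf : ∀ k ∈ localInt E c N JV v, 𝓢.omegaLoc v (localLineInl E c N e JV JW v k) f = f) :
    ∃ a : ℂ, f = a • unitVec F (Fin n) v := by
  have hmem : f ∈ Representation.fixedPoints ((𝓢.omegaLoc v).comp (localLineInl E c N e JV JW v)) (localInt E c N JV v) :=
    (Representation.mem_fixedPoints _ _ _).2 hf
  rw [fixedPoints_omegaLoc_comp_localLineInl_localInt_eq_span_unitVec_of_frame E c N e JV JW hJW0 hcδ hδ hd T hT hJ hJh v 𝓢 hTd w₀ hw₀ h2 hδu
    hcond hTi hunr hy hys hyi hysi hframe, Submodule.mem_span_singleton] at hmem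
  obtain ⟨a, ha⟩ := hmem
  exact ⟨a, ha.symm⟩

end PullBackOmega

end Summit.HodgeConjecture.HodgeConjecture.Cruxes.HLiu418.K2LiuInertWeilSphericalLine

end
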